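import Literature.MathematicalPhysics.QuantumFieldTheory.Balaban1983to89.B9SupplySockB9P3ZdFrameXi

/-!
# `Balaban1983to89.B9SupplySockB9P3ZdFrameXiCompare` — [Balaban1985BackgroundPropagators] (3.43)–(3.45) p. 398: THE Ξ READING OF THE HÖLDER BLOCK IS THE STRONGER ONE —
# in the ultraviolet regime `Lᵐη ≤ 1` print's ξ-scaled cut-off norm is `≤` the tree's η-scaled one, so `Ineq343_345` at the Ξ frame IMPLIES `Ineq343_345` at `geoZd`
# (non-negative constants): Theorem 3.3 typers may target the Ξ reading only; every `geoZd` consumer is fed through this file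

statement-level skeleton of published theorems with citation tags; proofs where landed; nothing here is a claim about the
Yang–Mills mass gap

PDF held: `paper:balaban1985-cmp99-background-propagators` p. 398 ((3.43)–(3.45), «ξ = L^{−j}»).  BY NAME: this seat's `B9SupplySockB9P3ZdFrameXi` (`cutHXi`, `geoZdXi`,
`GAZdXiOfOps`), the tree's `B9SupplySockB9P3ZdFrame.cutHZd ∕ geoZd`, `B9SupplySockB9P3ZdLocalLettersOfOps.GAZdOfOps`.

WHY THIS FILE (cell `pub-ymgap`, seat `pub-ymgap-dag-n06-w2` (g3), node N06 = [B9]; CLAIM-7; count-neutral).  Two readings of (3.43) now live in the tree: the η-scaled one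
(`geoZd`, all landed consumers) and print's ξ-scaled one (Ξ, the member-uniform Hölder constant).  This file orders them: `‖ζ‖^ξ_β ≤ ‖ζ‖^η_β` whenever `Lʲη ≤ 1`, hence the
Ξ block implies the `geoZd` block on every member with `Lᵐη ≤ 1` (the regime of the whole programme, `η = L^{−k}`, `m ≤ k`) for non-negative `Bβ`, `Bεβ`.

WHAT IS PROVED (kernel, 0 sorry; proof lane — no `def`).  `rpow_scale_le_one` · ★ `cutHXi_le_cutHZd` · ★★ `ineq343_345_zd_of_xi`.
HONEST SCOPE.  Order bookkeeping between two typings; no estimate of [B9]; count-neutral; N05∕N06 NOT discharged; one finite lattice programme at fixed `ε`; R4 closes the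
conditional finite-𝕋⁴ rung `BalabanLadder.UV` only; nothing continuum ∕ ℝ⁴ ∕ OS ∕ mass-gap ∕ Clay.  Unit `pub-ymgap-dag-n06-w2` (g3), 2026-08-28.
-/

noncomputable section

namespace Literature.MathematicalPhysics.QuantumFieldTheory.Balaban1983to89.B9SupplySockB9P3ZdFrameXiCompare

open B9Eq340HolderZd (AdmPair)
open B9SupplySockB9P3ZdLetters (OpsZd)
open B9SupplySockB9P3ZdFrame (MemberZd BSite CfgZd geoZd cutHZd cutSupZd)
open B9SupplySockB9P3ZdLocalLettersOfOps (GAZdOfOps)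
open B9SupplySockB9P3ZdFrameXi (cutHXi geoZdXi GAZdXiOfOps)

-- `Site` alone could resolve to the torus sites of `Setup.lean`; re-export the `ℤ^d` sites of `B7Prop1Explicit`.
export B7Prop1Explicit (Site)

variable {d : ℕ}

/-- `(Lʲη)^β ≤ 1` for `Lʲη ≤ 1`, `0 ≤ Lʲη`, `0 ≤ β`. [cite: Balaban1985BackgroundPropagators, (3.43) p.398 («ξ = L^{−j}», η = L^{−k}; bookkeeping)] -/
theorem rpow_scale_le_one {t β : ℝ} (ht0 : 0 ≤ t) (ht1 : t ≤ 1) (hβ : 0 ≤ β) : t ^ β ≤ 1 :=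
  Real.rpow_le_one ht0 ht1 hβ

/-- ★ **PRINT'S ξ-SCALED CUT-OFF NORM IS BELOW THE η-SCALED ONE** when `Lʲη ≤ 1` (`0 ≤ β`, `0 ≤ η`): `‖ζ‖^ξ_β + |ζ| ≤ [ζ]_{β,η} + |ζ|`.
[cite: Balaban1985BackgroundPropagators, (3.43) p.398, (3.40) p.397] -/
theorem cutHXi_le_cutHZd (L : ℕ) {η : ℝ} (hη : 0 ≤ η) {β : ℝ} (hβ : 0 ≤ β) (len : Site d → ℝ) {j : ℕ} (hj : (L : ℝ) ^ j * η ≤ 1) (ζ : Site d → ℝ) :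
    cutHXi L η β len j ζ ≤ cutHZd η β len ζ := by
  unfold cutHXi cutHZd
  refine add_le_add ?_ le_rfl
  have hsup : 0 ≤ ⨆ p : AdmPair η len, |ζ p.1.2 - ζ p.1.1| / (η * len (p.1.2 - p.1.1)) ^ β :=
    Real.iSup_nonneg fun p => div_nonneg (abs_nonneg _) (Real.rpow_nonneg (mul_nonneg hη p.2.1.le) β)
  have h1 : ((L : ℝ) ^ j * η) ^ β ≤ 1 := rpow_scale_le_one (by positivity) hj hβ
  calc ((L : ℝ) ^ j * η) ^ β * (⨆ p : AdmPair η len, |ζ p.1.2 - ζ p.1.1| / (η * len (p.1.2 - p.1.1)) ^ β)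
      ≤ 1 * (⨆ p : AdmPair η len, |ζ p.1.2 - ζ p.1.1| / (η * len (p.1.2 - p.1.1)) ^ β) := mul_le_mul_of_nonneg_right h1 hsup
    _ = _ := one_mul _

variable {𝔸 : Type} [CStarAlgebra 𝔸] {L : ℕ} {len : Site d → ℝ}

/-- ★★ **THE HÖLDER BLOCK AT Ξ IMPLIES THE HÖLDER BLOCK AT `geoZd`** on a member in the ultraviolet regime `Lᵐη ≤ 1` (`1 ≤ L`), for non-negative `Bβ`, `Bεβ`: (3.43) and (3.45)
carry the smaller cut-off norm at Ξ (`cutHXi_le_cutHZd`), (3.44) is identical.  So every landed `geoZd` consumer (g2's `holderAtδ2_zd_of_finite`, …) is fed by the print-exact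
reading, and Theorem 3.3 need only be typed at Ξ. [cite: Balaban1985BackgroundPropagators, (3.43)–(3.45) p.398, Thm 3.3 p.399] -/
theorem ineq343_345_zd_of_xi (hL : 1 ≤ L) {x : MemberZd d L} (hUV : (L : ℝ) ^ x.m * x.i.η ≤ 1) {ops : OpsZd d 𝔸}
    {Bβ Bε : ℝ → ℝ} {Bεβ : ℝ → ℝ → ℝ} (hBβ : ∀ β, 0 ≤ Bβ β) (hBεβ : ∀ ε β, 0 ≤ Bεβ ε β) {δ₀ : ℝ} {U : CfgZd d 𝔸}
    (h : B9.Ineq343_345 (GAZdXiOfOps 𝔸 L len x ops) Bβ Bε Bεβ δ₀ U) : B9.Ineq343_345 (GAZdOfOps 𝔸 L len x ops) Bβ Bε Bεβ δ₀ U := by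
  have hη : 0 ≤ x.i.η := x.i.hη.le
  have hscale : ∀ y : BSite L x, (L : ℝ) ^ y.1.1 * x.i.η ≤ 1 := fun y => by
    have hL1 : (1 : ℝ) ≤ L := by exact_mod_cast hL
    exact le_trans (mul_le_mul_of_nonneg_right (pow_le_pow_right₀ hL1 y.2.1) hη) hUV
  refine ⟨fun β J ζ y y' hβ0 hβ1 hζ hJ => ?_, fun ε J y y' hε hε1 hJ => h.2.1 ε J y y' hε hε1 hJ, fun ε β J ζ y y' hε hε1 hβ0 hβ1 hζ hJ => ?_⟩
  · have h1 := h.1 β J (y, ζ) y y' hβ0 hβ1 ⟨rfl, hζ⟩ hJ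
    refine h1.trans ?_
    have hc := cutHXi_le_cutHZd L hη hβ0 len (hscale y) ζ
    have hn : 0 ≤ (geoZd 𝔸 L len x).supNorm J := Real.iSup_nonneg fun _ => norm_nonneg _
    have hA : 0 ≤ Bβ β * (geoZd 𝔸 L len x).len y ^ (1 - β) :=
      mul_nonneg (hBβ β) (Real.rpow_nonneg (by show 0 ≤ (L : ℝ) ^ y.1.1 * x.i.η; positivity) _)
    have := mul_le_mul_of_nonneg_left hc hA
    exact mul_le_mul_of_nonneg_right (mul_le_mul_of_nonneg_right this (Real.exp_nonneg _)) hn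
  · have h1 := h.2.2 ε β J (y, ζ) y y' hε hε1 hβ0 hβ1 ⟨rfl, hζ⟩ hJ
    refine h1.trans ?_
    have hc := cutHXi_le_cutHZd L hη hβ0 len (hscale y) ζ
    have hn : 0 ≤ (geoZd 𝔸 L len x).holder (β + ε) J + (geoZd 𝔸 L len x).supNorm J :=
      add_nonneg (B9SupplySockB9P3ZdLocalLettersOfOps.holder0_nonneg hη (β + ε) len (1 : Site d → Fin d → 𝔸ˣ) J) (Real.iSup_nonneg fun _ => norm_nonneg _)
    have hA : 0 ≤ Bεβ ε β * (geoZd 𝔸 L len x).len y ^ (-β) :=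
      mul_nonneg (hBεβ ε β) (Real.rpow_nonneg (by show 0 ≤ (L : ℝ) ^ y.1.1 * x.i.η; positivity) _)
    have := mul_le_mul_of_nonneg_left hc hA
    exact mul_le_mul_of_nonneg_right (mul_le_mul_of_nonneg_right this (Real.exp_nonneg _)) hn

end Literature.MathematicalPhysics.QuantumFieldTheory.Balaban1983to89.B9SupplySockB9P3ZdFrameXiCompare

end
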